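import Literature.IUT.HodgeTheaters.GlobalFrobenioidsCyclotomes
import HarnessLib

/-!
# [IUTchI] Example 5.1 (iv): the decomposition groups `Π_{𝔭₀}` described as "the elements that fix
# `𝒪^⊿_𝔭`" are CLOSED — `DecompIsStabilizer ⟹ IsClosedDecomp` at the interface (PROOF-ONLY)

Mochizuki, *Inter-universal Teichmüller theory I*, §5, Example 5.1 (iv), kurims manuscript (May 2020)
p. 126 l. 41–52 (cell render lit/IUTchI-EX51-i-iv-vii-VERBATIM.md of the kurims PDF, `cat -n` numbering)
([IUTchI] Ex 5.1 (iv) p.126) [claim: Mochizuki2012, status: disputed]: "Thus, by allowing `A` to vary among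
the Frobenius-trivial objects of `†ℱ^⊛` that lie over Galois objects of `†𝒟^⊛` and considering the way in which
the natural action of `Aut_{†ℱ^⊛}(A)` on `𝒪^×(A^birat)` permutes the various submonoids `𝒪^⊳_𝔭`, it follows
that for each `𝔭₀ ∈ Prime(Φ_{†ℱ^⊛}(A₀))`, where `A₀ ∈ Ob(†ℱ^⊛)` lies over a terminal object of `†𝒟^⊛`, we
obtain a closed subgroup [well-defined up to conjugation] `Π_{𝔭₀} ⊆ π₁(†𝒟^⊛)` by considering the elements of
`Aut_{†ℱ^⊛}(A)` that fix the submonoid `𝒪^⊳_𝔭`, for some system of `𝔭`'s lying over `𝔭₀`. That is to say, in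
more intuitive terms, the subgroup `Π_{𝔭₀}` is simply the decomposition group associated to some `v ∈ 𝕍_mod`."
(The word "closed" is set in italics in print; `𝒪^⊳_𝔭` is written `𝒪^⊿_𝔭` in the typer's docstrings below.)

STATE OF THE TREE.  abc-iut-L5-t1 types the data of (iv) as the INTERFACE `BirationalData G`
(`GlobalFrobenioidsModel.lean`: the pair `π₁(†𝒟^⊛) = G ↷ 𝒪̃^⊛×` — a profinite group acting on a discrete
abelian group, continuity recorded as the field `isOpen_stabilizer` —, the integral submonoids
`𝒪^⊿_𝔭 = Oint 𝔭`, the primes `𝔭₀` with their subgroups `Π_{𝔭₀} = decomp 𝔭₀`), the printed DESCRIPTION of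
`Π_{𝔭₀}` as the typed predicate `BirationalData.DecompIsStabilizer` ("`Π_{𝔭₀}` is the stabiliser of
`𝒪^⊿_𝔭` for some `𝔭` over `𝔭₀`"; plan/FACT-LIST F-2584) and the printed CLOSEDNESS as the separate typed
predicate `BirationalData.IsClosedDecomp` (`GlobalFrobenioidsCyclotomes.lean`; F-2576), which nothing in
the tree produced.

THIS FILE (PROOF-ONLY: no `def`, no `instance`, no `structure`; nothing of the typer's files is edited or
restated; abc-iut-w4-d050 gen 5, SUBDAG-IUTchI-Ex51 row E51/L18) proves, for EVERY datum
`β : BirationalData G` — the genuine one included —, that the description implies the closedness: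

* `BirationalData.isOpen_setOf_smul_mem` — for `x ∈ 𝒪̃^⊛×` and any `T ⊆ 𝒪̃^⊛×`, `{g | g • x ∈ T}` is open in
  `G` (the orbit map `g ↦ g • x` is constant on the left cosets of the open stabiliser of `x`);
* `BirationalData.isClosed_setOf_smul_mem` — it is also closed (its complement has the same shape);
* `BirationalData.isClosed_setOf_mem_iff_smul_mem` — `{g | x ∈ 𝒪^⊿_𝔭 ↔ g • x ∈ 𝒪^⊿_𝔭}` is closed;
* `BirationalData.isClosed_setOf_fixes` — "the elements that fix the submonoid `𝒪^⊿_𝔭`",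
  `{g | ∀ x, x ∈ 𝒪^⊿_𝔭 ↔ g • x ∈ 𝒪^⊿_𝔭}`, form a closed subset of `G` (an intersection of the previous);
* `BirationalData.isClosed_decomp_of_decompIsStabilizer`, `BirationalData.isClosedDecomp_of_decompIsStabilizer`
  — hence `DecompIsStabilizer β → IsClosedDecomp β`.

So the "closed" of p. 126 is not an extra assumption on the data: it follows from the printed description of
`Π_{𝔭₀}` and the continuity of `π₁(†𝒟^⊛) ↷ 𝒪̃^⊛×`.  HONEST LABEL: a law derived at the interface; nothing
here constructs the genuine datum, asserts any statement of [IUTchI], or takes a side on [IUTchIII]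
Cor. 3.12; typed ≠ proved.  (v2: doc-only — the p. 126 quotation above made verbatim, referee flag M19-F12;
no declaration changed.)
-/

namespace Literature.IUT.HodgeTheaters

namespace BirationalData

universe u

variable {G : ProfiniteGrp.{u}} (β : BirationalData G)

/-- For `x ∈ 𝒪̃^⊛×` and any subset `T ⊆ 𝒪̃^⊛×`, the set `{g ∈ π₁(†𝒟^⊛) | g • x ∈ T}` is OPEN: it is a union
of left cosets of the stabiliser of `x`, which is open by the continuity datum `isOpen_stabilizer` of the
interface ("topological group acting continuously on a discrete abelian group", p. 126).
([IUTchI] Ex 5.1 (iv) p.126) [claim: Mochizuki2012, status: disputed] -/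
theorem isOpen_setOf_smul_mem (x : β.Otilde) (T : Set β.Otilde) :
    IsOpen {g : G | g • x ∈ T} := by
  rw [isOpen_iff_forall_mem_open]
  intro g hg
  refine ⟨(fun s : G => g * s) '' (MulAction.stabilizer G x : Set G), ?_, ?_, ?_⟩
  · rintro _ ⟨s, hs, rfl⟩
    show (g * s) • x ∈ T
    rw [mul_smul, MulAction.mem_stabilizer_iff.mp hs]
    exact hg
  · exact isOpenMap_mul_left g _ (β.isOpen_stabilizer x)
  · exact ⟨1, (MulAction.stabilizer G x).one_mem, mul_one g⟩

/-- … and it is CLOSED as well: its complement `{g | g • x ∈ Tᶜ}` has the same shape.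
([IUTchI] Ex 5.1 (iv) p.126) [claim: Mochizuki2012, status: disputed] -/
theorem isClosed_setOf_smul_mem (x : β.Otilde) (T : Set β.Otilde) :
    IsClosed {g : G | g • x ∈ T} := by
  rw [← isOpen_compl_iff]
  have h : ({g : G | g • x ∈ T} : Set G)ᶜ = {g : G | g • x ∈ Tᶜ} := by
    ext g
    simp
  rw [h]
  exact β.isOpen_setOf_smul_mem x Tᶜ

/-- For `x ∈ 𝒪̃^⊛×` and a prime `𝔭`, the set of `g ∈ π₁(†𝒟^⊛)` with `x ∈ 𝒪^⊿_𝔭 ↔ g • x ∈ 𝒪^⊿_𝔭` is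
closed (it is `{g | g • x ∈ 𝒪^⊿_𝔭}` or `{g | g • x ∉ 𝒪^⊿_𝔭}` according as `x ∈ 𝒪^⊿_𝔭` or not).
([IUTchI] Ex 5.1 (iv) p.126) [claim: Mochizuki2012, status: disputed] -/
theorem isClosed_setOf_mem_iff_smul_mem (x : β.Otilde) (p : β.PrimeIdx) :
    IsClosed {g : G | x ∈ β.Oint p ↔ g • x ∈ β.Oint p} := by
  by_cases hx : x ∈ β.Oint p
  · have h : ({g : G | x ∈ β.Oint p ↔ g • x ∈ β.Oint p} : Set G) =
        {g : G | g • x ∈ (β.Oint p : Set β.Otilde)} := by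
      ext g
      simp [hx]
    rw [h]
    exact β.isClosed_setOf_smul_mem x _
  · have h : ({g : G | x ∈ β.Oint p ↔ g • x ∈ β.Oint p} : Set G) =
        {g : G | g • x ∈ (β.Oint p : Set β.Otilde)ᶜ} := by
      ext g
      simp [hx]
    rw [h]
    exact β.isClosed_setOf_smul_mem x _

/-- **"the elements … that fix the submonoid `𝒪^⊿_𝔭`" form a CLOSED subset of `π₁(†𝒟^⊛)`** (p. 126): the
set `{g | ∀ x, x ∈ 𝒪^⊿_𝔭 ↔ g • x ∈ 𝒪^⊿_𝔭}` is the intersection over `x` of the closed sets of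
`isClosed_setOf_mem_iff_smul_mem`. ([IUTchI] Ex 5.1 (iv) p.126) [claim: Mochizuki2012, status: disputed] -/
theorem isClosed_setOf_fixes (p : β.PrimeIdx) :
    IsClosed {g : G | ∀ x : β.Otilde, x ∈ β.Oint p ↔ g • x ∈ β.Oint p} := by
  have h : ({g : G | ∀ x : β.Otilde, x ∈ β.Oint p ↔ g • x ∈ β.Oint p} : Set G) =
      ⋂ x : β.Otilde, {g : G | x ∈ β.Oint p ↔ g • x ∈ β.Oint p} := by
    ext g
    simp only [Set.mem_setOf_eq, Set.mem_iInter]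
  rw [h]
  exact isClosed_iInter fun x => β.isClosed_setOf_mem_iff_smul_mem x p

/-- **`Π_{𝔭₀}` is closed** whenever it is as described in print: if `Π_{𝔭₀}` is the stabiliser of `𝒪^⊿_𝔭`
for some `𝔭` over `𝔭₀` (the typed predicate `DecompIsStabilizer`, F-2584), then `Π_{𝔭₀} ⊆ π₁(†𝒟^⊛)` is
a closed subgroup ("we obtain a *closed* subgroup … `Π_{𝔭₀} ⊆ π₁(†𝒟^⊛)` by considering the elements of
`Aut_{†ℱ^⊛}(A)` that fix the submonoid `𝒪^⊿_𝔭`", p. 126). ([IUTchI] Ex 5.1 (iv) p.126)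
[claim: Mochizuki2012, status: disputed] -/
theorem isClosed_decomp_of_decompIsStabilizer (h : β.DecompIsStabilizer) (p0 : β.PrimeIdx0) :
    IsClosed (β.decomp p0 : Set G) := by
  obtain ⟨p, -, hp⟩ := h.out p0
  have hset : (β.decomp p0 : Set G) =
      {g : G | ∀ x : β.Otilde, x ∈ β.Oint p ↔ g • x ∈ β.Oint p} := by
    ext g
    exact hp g
  rw [hset]
  exact β.isClosed_setOf_fixes p

/-- **E51/L18, the CLOSED clause, at the interface: `DecompIsStabilizer ⟹ IsClosedDecomp`.**  For every
datum `β : BirationalData G` (the genuine `π₁(†𝒟^⊛) ↷ 𝒪̃^⊛×` included), the printed description of the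
decomposition groups (typed predicate `DecompIsStabilizer`, plan/FACT-LIST F-2584) implies their printed
closedness (typed predicate `IsClosedDecomp`, F-2576) — so the latter is never an additional hypothesis.
([IUTchI] Ex 5.1 (iv) p.126) [claim: Mochizuki2012, status: disputed] -/
theorem isClosedDecomp_of_decompIsStabilizer (h : β.DecompIsStabilizer) : β.IsClosedDecomp :=
  ⟨fun p0 => β.isClosed_decomp_of_decompIsStabilizer h p0⟩

end BirationalData

end Literature.IUT.HodgeTheaters
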